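import Summits.Langlands.Langlands.Theorems.PhantomRMYoshidaResiduallyYoshidaLiftingRealisedCocycleIdentity
import Summits.Langlands.Langlands.Theorems.PhantomRMYoshidaResiduallyYoshidaLiftingResidualSplitting
import HarnessLib

/-!
# Route `PhantomRMYoshida`, crux `ResiduallyYoshidaLifting` (stmt-Langlands-13639), line `sector-klingen-split`:
# stub K1 `stub_realisedCocycleLocallyConstant` — a realised cocycle is locally constant

Stub-worker file of lead prover-line-stmt-Langlands-13639-c4-0 (skeleton rev 11, sub-goal K1; companion of the
1-cocycle identity `Ribet.stub_realisedCocycleIdentity`, p151532).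

**Theorem (`stub_realisedCocycleLocallyConstant`, registered signature verbatim).**  Let `r : Γ_ℚ → GL₄(ℚ̄_p)` be a
framed (continuous) Galois representation, `(P, rint)` an integral frame (`rint g ∈ GL₄(ℤ̄_p)`, `rint = P⁻¹ r P` in
`GL₄(ℚ̄_p)`), and suppose that the reduction of `rint` through a ring map `red : ℤ̄_p → k` to a field of
characteristic `p` is `h (σ̄ g, B g; 0, σ̄' g) h⁻¹`.  Then the cochain `B : Γ_ℚ → M₂(k)` is LOCALLY CONSTANT for the
Krull topology (so the realised class `[B]` is a class of continuous cochains for the discrete `k`).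

**Proof.**
1. The entries of the integral frame are continuous into `ℚ̄_p`: `((rint g) i j : ℚ̄_p) = (P⁻¹ · r g · P) i j` and `r`
   is continuous (`isLocallyConstant_map_red_of_integralFrame`).
2. The reduction `g ↦ red (rint g) ∈ GL_n(k)` is locally constant: near `g₀` every entry moves by an element of norm
   `< 1` (continuity, the open unit ball of the ultrametric `ℚ̄_p`), and `red` kills the elements of `ℤ̄_p` of norm `< 1`
   (`red_eq_zero_of_norm_lt_one`, characteristic `p`), so `red (rint g) = red (rint g₀)` eventually.
3. `B g` is the `(1,2)` block of `h⁻¹ · red (rint g) · h` transported along `Fin 4 ≃ Fin 2 ⊕ Fin 2`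
   (`Matrix.toBlocks_fromBlocks₁₂`), a function of `red (rint g)`: compose (`IsLocallyConstant.comp`).

No new definitions, no named fact taken as a hypothesis; Mathlib + the two landed files above.
-/

noncomputable section

-- `Summit.Langlands.Langlands.…` (summit = sub-problem name, D-0017 layout) trips `dupNamespace` on every decl.
set_option linter.dupNamespace false
set_option autoImplicit false

open scoped Matrix Topology
open Literature.NumberTheory.GaloisRepresentations
open Summit.Langlands.Langlands.Cruxes.ResiduallyYoshidaLifting.EndoscopicCrossingEuler (red_eq_zero_of_norm_lt_one)

namespace Summit.Langlands.Langlands.Cruxes.ResiduallyYoshidaLifting.SectorKlingenSplit.Fibre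

section Reduction

variable {p : ℕ} [Fact p.Prime]

/-- **Steps 1–2.**  The reduction through a characteristic-`p` ring map `red : ℤ̄_p → k` of an integral frame
`rint = P⁻¹ r P` of a continuous `r : Γ_ℚ → GL_n(ℚ̄_p)` is locally constant on `Γ_ℚ`: the entries
`(rint g) i j = (P⁻¹ r g P) i j` are continuous into `ℚ̄_p`, and `red` kills the open unit ball of `ℤ̄_p`. [folklore] -/
theorem isLocallyConstant_map_red_of_integralFrame {k : Type*} [Field k] [CharP k p]
    (red : Valued.integer (PadicAlgCl p) →+* k) {n : ℕ}
    (r : FramedGaloisRep ℚ (PadicAlgCl p) n) (P : GL (Fin n) (PadicAlgCl p))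
    (rint : Field.absoluteGaloisGroup ℚ →* GL (Fin n) (Valued.integer (PadicAlgCl p)))
    (hP : ∀ g, Matrix.GeneralLinearGroup.map (Valued.integer (PadicAlgCl p)).subtype (rint g) = P⁻¹ * r g * P) :
    IsLocallyConstant fun g => Matrix.GeneralLinearGroup.map red (rint g) := by
  -- Step 1: the entries of `rint g`, read in `ℚ̄_p`, are the entries of the continuous `P⁻¹ r g P`
  have hentry : ∀ g i j, (((rint g : GL (Fin n) (Valued.integer (PadicAlgCl p))) :
      Matrix (Fin n) (Fin n) (Valued.integer (PadicAlgCl p))) i j : PadicAlgCl p) =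
      ((P⁻¹ * r g * P : GL (Fin n) (PadicAlgCl p)) : Matrix (Fin n) (Fin n) (PadicAlgCl p)) i j := by
    intro g i j
    rw [← hP g]
    rfl
  obtain ⟨E, hcont, hE⟩ : ∃ E : Field.absoluteGaloisGroup ℚ → Matrix (Fin n) (Fin n) (PadicAlgCl p),
      Continuous E ∧ ∀ g i j, (((rint g : GL (Fin n) (Valued.integer (PadicAlgCl p))) :
        Matrix (Fin n) (Fin n) (Valued.integer (PadicAlgCl p))) i j : PadicAlgCl p) = E g i j :=
    ⟨fun g => ((P⁻¹ * r g * P : GL (Fin n) (PadicAlgCl p)) : Matrix (Fin n) (Fin n) (PadicAlgCl p)),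
      Units.continuous_val.comp ((continuous_const.mul (map_continuous r)).mul continuous_const), hentry⟩
  -- Step 2: near `g₀` every entry moves by less than `1` in norm, which `red` does not see
  rw [IsLocallyConstant.iff_eventually_eq]
  intro g₀
  have hev : ∀ i j, ∀ᶠ g in 𝓝 g₀, ‖E g i j - E g₀ i j‖ < 1 := fun i j =>
    (((hcont.matrix_elem i j).sub continuous_const).norm.continuousAt (x := g₀)).eventually_lt
      continuous_const.continuousAt (by simp only [Pi.sub_apply, sub_self, norm_zero, zero_lt_one])
  filter_upwards [Filter.eventually_all.2 fun i => Filter.eventually_all.2 fun j => hev i j] with g hg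
  refine Matrix.GeneralLinearGroup.ext fun i j => ?_
  rw [Matrix.GeneralLinearGroup.map_apply, Matrix.GeneralLinearGroup.map_apply, ← sub_eq_zero, ← map_sub]
  refine red_eq_zero_of_norm_lt_one red _ ?_
  have hij := hg i j
  rw [← hE, ← hE] at hij
  exact_mod_cast hij

end Reduction

/-- **Registered statement `stub_realisedCocycleLocallyConstant` (K1)**: a residual cocycle `B` REALISED by a framed Galois
representation `r : Γ_ℚ → GL₄(ℚ̄_p)` in an integral frame `rint = P⁻¹ r P` (reduction through `red : ℤ̄_p → k`,
`char k = p`, conjugate by `h` to `(σ̄, B; 0, σ̄')`) is locally constant on `Γ_ℚ` (Krull topology): `B g` is a block of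
`h⁻¹ · red (rint g) · h`, and `g ↦ red (rint g)` is locally constant (`isLocallyConstant_map_red_of_integralFrame`). [folklore] -/
theorem stub_realisedCocycleLocallyConstant :
    ∀ (p : ℕ) [Fact p.Prime] (k : Type) [Field k] [CharP k p] [TopologicalSpace k] [DiscreteTopology k]
      (red : Valued.integer (PadicAlgCl p) →+* k)
      (σ σ' : FramedGaloisRep ℚ k 2) (r : FramedGaloisRep ℚ (PadicAlgCl p) 4)
      (P : GL (Fin 4) (PadicAlgCl p)) (rint : Field.absoluteGaloisGroup ℚ →* GL (Fin 4) (Valued.integer (PadicAlgCl p)))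
      (h : GL (Fin 4) k) (B : Field.absoluteGaloisGroup ℚ → Matrix (Fin 2) (Fin 2) k),
      (∀ g, Matrix.GeneralLinearGroup.map (Valued.integer (PadicAlgCl p)).subtype (rint g) = P⁻¹ * r g * P) →
      (∀ g, (Matrix.GeneralLinearGroup.map red (rint g)).val =
        h.val * Matrix.reindex finSumFinEquiv finSumFinEquiv (Matrix.fromBlocks (σ g).val (B g) 0 (σ' g).val) * (h⁻¹).val) →
      IsLocallyConstant B := by
  intro p _ k _ _ _ _ red σ σ' r P rint h B hP hred
  -- Step 3: `B g` is the `(1,2)` block of `h⁻¹ · red (rint g) · h`, read in `Fin 2 ⊕ Fin 2`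
  have hB : B = (fun M : GL (Fin 4) k =>
      ((Matrix.reindex (finSumFinEquiv : Fin 2 ⊕ Fin 2 ≃ Fin (2 + 2)) (finSumFinEquiv : Fin 2 ⊕ Fin 2 ≃ Fin (2 + 2))).symm
        ((h⁻¹).val * M.val * h.val)).toBlocks₁₂) ∘ fun g => Matrix.GeneralLinearGroup.map red (rint g) := by
    funext g
    simp only [Function.comp_apply]
    rw [hred g]
    simp only [Matrix.mul_assoc, Units.inv_mul_cancel_left, Units.inv_mul, Matrix.mul_one, Equiv.symm_apply_apply,
      Matrix.toBlocks_fromBlocks₁₂]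
  rw [hB]
  exact (isLocallyConstant_map_red_of_integralFrame red r P rint hP).comp _

end Summit.Langlands.Langlands.Cruxes.ResiduallyYoshidaLifting.SectorKlingenSplit.Fibre

end
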